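import Literature.AlgebraicGeometry.AbelianSchemes.AbelianSchemeIsLambdaOfAtBaseChange
import HarnessLib

/-!
# Base change of a polarisation of an abelian scheme and of its type
# ([MFK94] Ch. 6 §2 Def. 6.3, Ch. 7 §2 Def. 7.2 and App. 7A)

Layer `Literature/AlgebraicGeometry/AbelianSchemes`, namespace
`Literature.AlgebraicGeometry.AbelianSchemes.AbelianSchemeOver.Polarization`.  Cell `hodgecm-mathlib`, rung-0 carrier
junction D-BC∃ (D2-third §3b); consumer: the assembler's `PolarizedAbelianSchemeWithLevel.baseChangeOfPolarization`
(`pol′ := pol.baseChange g`, `hlam := baseChange_lam_left_comp_fst`, `hT := HasType.baseChange h`,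
`hpol := pol.transfer_baseChange g`).  One definition with body (`Polarization.baseChange`), theorems; no named fact,
no instance, no notation.

For a polarisation `pol : A.Polarization D` of an abelian scheme `A/S` (★ `AbelianSchemePolarization`: an `S`-homomorphism
`λ : A → Â` that is `Λ(𝒪(Θ))` for an ample `Θ` at every geometric point) and `g : S' ⟶ S`:

* **`Polarization.baseChange (pol) (g) : (A.baseChange g).Polarization (D.baseChange g)`** — `λ ×_S S'` ([MFK94] Def. 7.2,
  closing sentence p. 129: the moduli functor is a functor «in the obvious way», i.e. by pull-back): `lam :=
  (Over.pullback g).map pol.lam` (a homomorphism since the base-change functor is monoidal, Mathlib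
  `Functor.map.instIsMonHom`), ample witness `e^*Θ` at `t` for the witness `Θ` at `t ≫ g` (★ `IsLambdaOfAt.baseChange`,
  `IsAmple.pullback` along the isomorphism `e`); `baseChange_lam` (rfl), `baseChange_lam_left_comp_fst`;
* **`Polarization.transfer_baseChange`** — literally the polarisation-transfer hypothesis `hpol` of ★
  `LevelStructure.IsSymplecticLiftable.of_fibreIso` for `A′ := A ×_S S'`, `pol′ := λ ×_S S'`, `e := fibreBaseChangeIso`
  (★ `IsLambdaOfAt.of_baseChange`);
* `mem_kerPointsAt_baseChange_iff` (`P' ∈ K(λ̄') ↔ e P' ∈ K(λ̄)`) and **`Polarization.HasType.baseChange :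
  pol.HasType δ → (pol.baseChange g).HasType δ`** ([MFK94] App. 7A: the type is read on the `Ω`-points of geometric
  fibres, and `fibrePointsMulEquiv : (A_{S'})_t(Ω) ≃* A_{t ≫ g}(Ω)` carries `K(λ̄')` onto `K(λ̄)`).

## References
* [MumfordFogartyKirwan1994] D. Mumford, J. Fogarty, F. Kirwan, *Geometric Invariant Theory*, 3rd ed. (1994), Ch. 6 §2
  Def. 6.3 (p. 120), Ch. 7 §2 Def. 7.2 (p. 129), App. 7A (pp. 234–235).
* [MumfordAV1970] D. Mumford, *Abelian Varieties* (1970), §13 (the group `K(L)`), §23 (type of a polarisation).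
* [Lan2013PELCompactifications] K.-W. Lan, *Arithmetic compactifications of PEL-type Shimura varieties* (2013), §1.3.6
  Lemma 1.3.6.6 (pp. 81–82).
* [GortzWedhorn2020] U. Görtz, T. Wedhorn, *Algebraic Geometry I*, 2nd ed. (2020), Section (4.7) (p. 135).
-/

universe u

open CategoryTheory CategoryTheory.Limits AlgebraicGeometry MonoidalCategory

noncomputable section

namespace Literature.AlgebraicGeometry.AbelianSchemes

open Literature.AlgebraicGeometry.Motives Literature.AlgebraicGeometry.AbelianVarieties
  Literature.AlgebraicGeometry.Modules
open scoped MonObj CategoryTheory.Obj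

namespace AbelianSchemeOver

variable {S S' : Scheme.{u}} (A : AbelianSchemeOver S) (g : S' ⟶ S) (D : A.DualPair)

/-! ### Base change of a polarisation, its transfer hypothesis `hpol`, and its type -/

namespace Polarization

variable {A} {D} (pol : A.Polarization D)

/-- **BASE CHANGE OF A POLARISATION** along `g : S' ⟶ S`: `λ ×_S S' : A_{S'} → Â_{S'}` — again a homomorphism
(Mathlib: a monoidal functor maps monoid morphisms to monoid morphisms), and at every geometric point `t` of `S'` of
the form `Λ(𝒪(e^*Θ))` for the ample `e^*Θ`, `Θ` the ample divisor of `λ` at `t ≫ g` ([MumfordFogartyKirwan1994,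
Def. 7.2, closing sentence p. 129]: the data pull back «in the obvious way»). [cite: MumfordFogartyKirwan1994, Ch. 6 §2 Definition 6.3 (p. 120) and Ch. 7 §2 Definition 7.2 (p. 129)] -/
def baseChange : (A.baseChange g).Polarization (D.baseChange g) where
  lam := (Over.pullback g).map pol.lam
  isMonHom := by
    haveI := pol.isMonHom
    exact Functor.map.instIsMonHom _ _ pol.lam
  exists_ample := fun Ω _ _ t => by
    obtain ⟨Θ, hΘ, hΛ⟩ := pol.exists_ample Ω (t ≫ g)
    haveI := A.isIso_toSchemeHom_fibreBaseChangeIso g t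
    exact ⟨A.divisorBaseChange g t Θ, hΘ.pullback _, IsLambdaOfAt.baseChange A g D t pol.lam Θ hΛ⟩

/-- The morphism of the base-changed polarisation is `(Over.pullback g).map λ` (definitional; the assembler's
`λ`-clause of `IsBaseChangeVia`). [cite: MumfordFogartyKirwan1994, Ch. 7 §2 Definition 7.2 (p. 129)] -/
@[simp]
theorem baseChange_lam : (pol.baseChange g).lam = (Over.pullback g).map pol.lam := rfl

/-- `(λ ×_S S').left ≫ pr_Â = pr_A ≫ λ.left`. [cite: MumfordFogartyKirwan1994, Ch. 7 §2 Definition 7.2 (p. 129)] -/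
@[reassoc]
theorem baseChange_lam_left_comp_fst :
    (pol.baseChange g).lam.left ≫ pullback.fst D.hat.X.hom g = pullback.fst A.X.hom g ≫ pol.lam.left := by
  simp only [baseChange_lam, Over.pullback_map_left]
  erw [pullback.lift_fst]

/-- **THE POLARISATION TRANSFER `hpol` FOR THE BASE CHANGE** — the hypothesis of
`LevelStructure.IsSymplecticLiftable.of_fibreIso` instantiated at `A′ := A ×_S S'`, `pol′ := λ ×_S S'`,
`e := fibreBaseChangeIso`: every ample `Θ'` with `λ̄' = Λ(𝒪(Θ'))` at `s'` pulls back along `e⁻¹` to an ample divisor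
with `λ̄ = Λ(𝒪((e⁻¹)^*Θ'))` at `s' ≫ g` (ampleness: pull-back along an isomorphism, Mathlib `IsAffineHom` of an iso;
the identity: `IsLambdaOfAt.of_baseChange`). [cite: MumfordFogartyKirwan1994, Ch. 7 §2 Definition 7.2 (p. 129)]
[cite: Lan2013PELCompactifications, §1.3.6 Lemma 1.3.6.6 (pp. 81–82)] -/
theorem transfer_baseChange :
    ∀ (Ω : Type u) [Field Ω] [IsAlgClosed Ω] (s' : Spec (.of Ω) ⟶ S')
      (Θ' : CartierDivisor ((A.baseChange g).fibre s').toAbelianVariety.X.left), Θ'.IsAmple →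
      (A.baseChange g).IsLambdaOfAt s' (D.baseChange g) (pol.baseChange g).lam Θ' →
      haveI : IsDominant (AbelianVariety.Hom.toSchemeHom (A.fibreBaseChangeIso g s').inv) :=
        AbelianVariety.isDominant_toSchemeHom_iso_hom (A.fibreBaseChangeIso g s').symm
      (Θ'.pullback (AbelianVariety.Hom.toSchemeHom (A.fibreBaseChangeIso g s').inv)).IsAmple ∧
        A.IsLambdaOfAt (s' ≫ g) D pol.lam (Θ'.pullback (AbelianVariety.Hom.toSchemeHom (A.fibreBaseChangeIso g s').inv)) := by
  intro Ω _ _ s' Θ' hΘ' hlam'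
  haveI := A.isIso_toSchemeHom_fibreBaseChangeIso_inv g s'
  exact ⟨hΘ'.pullback _, IsLambdaOfAt.of_baseChange A g D s' pol.lam Θ' hlam'⟩

/-- **Kernels on points correspond**: `P' ∈ K(λ̄')` iff `e P' ∈ K(λ̄)` under the fibre identification
`e : (A_{S'})_t ≅ A_{t ≫ g}`. [cite: MumfordAV1970, §13 (the group K(L))] -/
theorem mem_kerPointsAt_baseChange_iff {Ω : Type u} [Field Ω] (t : Spec (.of Ω) ⟶ S')
    (P' : ((A.baseChange g).fibre t).toAbelianVariety.Points Ω) :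
    P' ∈ (pol.baseChange g).kerPointsAt t ↔
      AlgPoints.map (A.fibreBaseChangeIso g t).hom.hom.hom.hom P' ∈ pol.kerPointsAt (t ≫ g) := by
  rw [Polarization.mem_kerPointsAt_iff, Polarization.mem_kerPointsAt_iff]
  change (A.baseChange g).valueAt t (D.baseChange g) ((Over.pullback g).map pol.lam) P' =
      (A.baseChange g).valueAt t (D.baseChange g) ((Over.pullback g).map pol.lam) 1 ↔ _
  rw [A.valueAt_baseChange_eq_iff g D t pol.lam P' 1]
  -- `e 1 = 1`
  have h1 : AlgPoints.map (A.fibreBaseChangeIso g t).hom.hom.hom.hom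
      (1 : ((A.baseChange g).fibre t).toAbelianVariety.Points Ω) = 1 := MonObj.one_comp _
  rw [h1]

/-- **THE TYPE IS STABLE UNDER BASE CHANGE**: if `λ` has type `δ` then so does `λ ×_S S'` — at a geometric point `t`
of `S'` the kernel of `λ̄'` on `Ω`-points is carried onto the kernel of `λ̄` at `t ≫ g` by the group isomorphism
`(A_{S'})_t(Ω) ≅ A_{t ≫ g}(Ω)` (`AbelianSchemeOver.fibrePointsMulEquiv`). [cite: MumfordFogartyKirwan1994, App. 7A (pp. 234–235)] -/
theorem HasType.baseChange {n : ℕ} {δ : Fin n → ℕ} (h : pol.HasType δ) : (pol.baseChange g).HasType δ := by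
  refine ⟨h.1, fun Ω _ _ t => ?_⟩
  obtain ⟨φ₀, hinj, hrange⟩ := h.2 Ω (t ≫ g)
  refine ⟨(A.fibrePointsMulEquiv g t).symm.toMonoidHom.comp φ₀, ?_, ?_⟩
  · exact (A.fibrePointsMulEquiv g t).symm.injective.comp hinj
  · ext P'
    rw [pol.mem_kerPointsAt_baseChange_iff g t P', ← hrange, Set.mem_range, Set.mem_range]
    constructor
    · rintro ⟨x, hx⟩
      refine ⟨x, ?_⟩
      rw [← hx]
      exact ((A.fibrePointsMulEquiv g t).apply_symm_apply (φ₀ x)).symm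
    · rintro ⟨x, hx⟩
      refine ⟨x, ?_⟩
      change (A.fibrePointsMulEquiv g t).symm (φ₀ x) = P'
      rw [MulEquiv.symm_apply_eq]
      exact hx

end Polarization

end AbelianSchemeOver

end Literature.AlgebraicGeometry.AbelianSchemes

end
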